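import Literature.NumberTheory.LFunctions.WeissKernel
import Literature.NumberTheory.LFunctions.ClassGroupLFunctionConvexity
import Literature.NumberTheory.LFunctions.ClassGroupCharacterEulerProduct
import Literature.NumberTheory.LFunctions.MontgomeryExplicitFormulaKernel
import Mathlib.Analysis.Fourier.Inversion
import HarnessLib

/-!
# Smoothed sums of class group characters with Weiss's kernel (Thorner–Zaman 2017, Lemma 4.4)

Topic `Literature/NumberTheory/LFunctions`, namespaces `…LFunctions.WeissKernel` (kernel analysis)
and `…LFunctions.NumberField` (the number-field statement).  Everything here is PROVED
(one definition with body, theorems; no named facts).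

For a number field `K`, a class group character `χ : Cl_K →* ℂˣ`, Weiss's kernel
`φ = φ_{m+1}` of `WeissKernel.lean` (parameter `A > 0`) and `u = log x`, the smoothed sum
`S_χ(u) = Σ_{𝔞 ≠ 0} χ([𝔞]) N𝔞^{−1} φ(u − log N𝔞)` (`= Σ_𝔞 χ(𝔞)N𝔞^{−1}Ψ(x/N𝔞)`) satisfies

  `|S_χ(u) − δ(χ) κ_K| ≤ (1/3) |d_K| e^{2n_K} · C · x^{−3/2}`, `C = majorConst A m (n_K+1)`,

`κ_K = Res_{s=1} ζ_K` (here `δ(χ)κ_K` is the value at `1` of the entire function `(s−1)L(s,χ)`,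
`classTwistedZeta₁`).  This is [ThornerZaman2017, Lemma 4.4] / Weiss 1983, Lemma 3.4 for the
class group (`H = 1`), with the convexity input replaced by the tree's uniform bound
`|(z − 1)L(z, χ)| ≤ |d_K| e^{2n_K} |z + 5/2|^{n_K+1}` (`Re z ≥ −1/2`,
`norm_sub_one_mul_classGroupLFunction_le`), so that the line can be moved to `Re s = 3/2`.

* `WeissKernel.differentiable_laplaceFactor` — `sinh(s/A)/(s/A)` is entire;
  `norm_laplaceFactor_pow_vertical_le`, `integrable_laplaceFactor_pow_vertical` — on vertical lines
  `|Ψ̂(σ+it)| ≤ 2e^{(m+1)|σ|/A} max(1,A)^{m+1}/(1+t²)` (`m ≥ 1`);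
* `WeissKernel.phi_eq_integral` — **Mellin (Fourier) inversion on any vertical line**:
  `φ_{m+1}(w) = (1/2π) ∫ e^{−w(σ+it)} Ψ̂(σ+it) dt` (`m ≥ 1`; Mathlib's Fourier inversion for the
  continuous integrable `φ(w)e^{σw}` whose transform `Ψ̂(σ − 2πiξ)` is integrable);
* `WeissKernel.smoothedSum a A m u = Σ_n a(n) n^{−1} φ_{m+1}(u − log n)` and
  `smoothedSum_eq_integral` — for any `a` with `Σ|a(n)|n^{−1−c} < ∞`,
  `S_a(u) = (1/2π) ∫ e^{−us} Ψ̂(s) L(a, 1 − s) dt`, `s = −c + it` (absolute convergence, Fubini);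
* `WeissKernel.norm_laplaceFactor_pow_mul_le` — the majorant `|Ψ̂(s)|(9/2+|t|)^N ≤ C/(1+t²)` on
  `|Re s| ≤ 3/2` for `m ≥ N + 2`, `C = majorConst A m N = 2e^{3(m+1)/(2A)}(11/2)^N(1+max(1,A))^{m+N+3}`;
* `WeissKernel.smoothedSum_eq_add_integral` — for `L(a,z) = F(z)/(z−1)` (`F` entire,
  `|F(z)| ≤ M|z+5/2|^N` on `Re z ≥ −1/2`): `S_a(u) = F(1) + (1/2π)∫_{Re s = 3/2} e^{−us}Ψ̂(s)F(1−s)/(−s) dt`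
  — the line moved across the simple pole at `s = 0` with the tree's
  `Montgomery.integral_vertical_div_sub_eq`; `norm_smoothedSum_sub_le` —
  `|S_a(u) − F(1)| ≤ (1/3) M C e^{−3u/2}`;
* `NumberField.norm_smoothedClassSum_sub_le` — the
  bound displayed above for `χ : Cl_K →* ℂˣ` (`F = Z₁_χ = (s−1)L(s,χ)`, `M = |d_K|e^{2n_K}`, `N = n_K+1`,
  `m ≥ n_K + 3`).

## References

* [ThornerZaman2017] J. Thorner, A. Zaman, *An explicit bound for the least prime ideal in the
  Chebotarev density theorem*, Algebra Number Theory 11 (2017), Lemma 4.4.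
* [Weiss1983] A. Weiss, *The least prime ideal*, J. reine angew. Math. 338 (1983), Lemma 3.4.
-/

noncomputable section

open MeasureTheory Real Complex Set Filter
open scoped Topology FourierTransform

namespace Literature.NumberTheory.LFunctions.WeissKernel

variable {A : ℝ}

/-! ### `sinh(s/A)/(s/A)` is entire -/

/-- `sinh(s/A)/(s/A) = A · dslope (sinh(·/A)) 0`. [folklore] -/
theorem laplaceFactor_eq_dslope (hA : 0 < A) (s : ℂ) :
    laplaceFactor A s = A * dslope (fun z : ℂ ↦ Complex.sinh (z / A)) 0 s := by
  have hA0 : (A : ℂ) ≠ 0 := by exact_mod_cast hA.ne'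
  by_cases hs : s = 0
  · subst hs
    rw [laplaceFactor, if_pos rfl, dslope_same]
    have h1 : HasDerivAt (fun z : ℂ ↦ z / A) ((A : ℂ)⁻¹) 0 := by
      simpa [div_eq_mul_inv] using (hasDerivAt_id (0 : ℂ)).mul_const ((A : ℂ)⁻¹)
    have hd : HasDerivAt (fun z : ℂ ↦ Complex.sinh (z / A)) (Complex.cosh (0 / A) * (A : ℂ)⁻¹) 0 := by
      have h2 := (Complex.hasDerivAt_sinh ((0 : ℂ) / A)).comp (0 : ℂ) h1
      exact h2
    rw [hd.deriv, zero_div, Complex.cosh_zero, one_mul, mul_inv_cancel₀ hA0]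
  · rw [laplaceFactor, if_neg hs, dslope_of_ne _ hs, slope_def_field, zero_div, Complex.sinh_zero,
      sub_zero, sub_zero]
    field_simp

/-- **`sinh(s/A)/(s/A)` is entire.** [folklore] -/
theorem differentiable_laplaceFactor (hA : 0 < A) : Differentiable ℂ (laplaceFactor A) := by
  have e : laplaceFactor A = fun s ↦ A * dslope (fun z : ℂ ↦ Complex.sinh (z / A)) 0 s :=
    funext (laplaceFactor_eq_dslope hA)
  rw [e]
  refine Differentiable.const_mul ?_ _
  have hd : Differentiable ℂ fun z : ℂ ↦ Complex.sinh (z / A) := by fun_prop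
  intro s
  by_cases hs : s = 0
  · subst hs
    obtain ⟨p, hp⟩ := hd.analyticAt 0
    exact hp.has_fpower_series_dslope_fslope.analyticAt.differentiableAt
  · rw [differentiableAt_dslope_of_ne hs]
    exact hd s

/-! ### Decay on vertical lines -/

/-- **`|Ψ̂(σ+it)| ≤ 2 e^{(m+1)|σ|/A} max(1,A)^{m+1} / (1 + t²)`** for `m ≥ 1`
(from `|Ψ̂| ≤ e^{k|σ|/A}` and `|Ψ̂| ≤ (A/|s|)^k e^{k|σ|/A}`). [cite: ThornerZaman2017, Lemma 4.3 (iii)] -/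
theorem norm_laplaceFactor_pow_vertical_le (hA : 0 < A) {m : ℕ} (hm : 1 ≤ m) (σ t : ℝ) :
    ‖laplaceFactor A (σ + t * I) ^ (m + 1)‖ ≤
      2 * Real.exp ((m + 1) * |σ| / A) * max 1 A ^ (m + 1) / (1 + t ^ 2) := by
  set k : ℕ := m + 1 with hk
  set E : ℝ := Real.exp ((m + 1 : ℕ) * |σ| / A) with hE
  have hE1 : 1 ≤ E := Real.one_le_exp (by positivity)
  have hM1 : 1 ≤ max 1 A := le_max_left _ _
  have hMA : A ≤ max 1 A := le_max_right _ _
  have hre : ((σ : ℂ) + t * I).re = σ := by simp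
  have h1 : ‖laplaceFactor A (σ + t * I) ^ (m + 1)‖ ≤ E := by
    have := norm_laplaceFactor_pow_le_exp hA ((σ : ℂ) + t * I) (m + 1)
    rwa [hre] at this
  have hEcast : Real.exp ((m + 1) * |σ| / A) = E := by rw [hE]; push_cast; ring_nf
  rw [hEcast]
  by_cases ht : |t| ≤ 1
  · -- `|t| ≤ 1`: `1 + t² ≤ 2`
    have ht2 : t ^ 2 ≤ 1 := by rw [← sq_abs]; nlinarith [abs_nonneg t]
    rw [le_div_iff₀ (by positivity)]
    calc ‖laplaceFactor A (σ + t * I) ^ (m + 1)‖ * (1 + t ^ 2) ≤ E * 2 := by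
          refine mul_le_mul h1 (by linarith) (by positivity) (by positivity)
      _ ≤ 2 * E * max 1 A ^ (m + 1) := by
          have : 1 ≤ max 1 A ^ (m + 1) := one_le_pow₀ hM1
          nlinarith
  · -- `|t| > 1`: `(A/|s|)^k ≤ (A/|t|)^k ≤ max(1,A)^k / t²`
    rw [not_le] at ht
    have ht0 : 0 < |t| := by linarith
    have hs0 : (σ : ℂ) + t * I ≠ 0 := by
      intro h; have := congrArg Complex.im h; simp at this; rw [this] at ht; norm_num at ht
    have h2 := norm_laplaceFactor_pow_le_div hA hs0 (m + 1)
    rw [hre] at h2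
    have hst : |t| ≤ ‖(σ : ℂ) + t * I‖ := by
      have := Complex.abs_im_le_norm ((σ : ℂ) + t * I); simpa using this
    have h3 : (A / ‖(σ : ℂ) + t * I‖) ^ (m + 1) ≤ (max 1 A / |t|) ^ (m + 1) := by
      refine pow_le_pow_left₀ (by positivity) ?_ _
      exact div_le_div₀ (by positivity) hMA ht0 hst
    -- `(M/|t|)^{m+1} ≤ M^{m+1}/t²` for `|t| ≥ 1`, `m ≥ 1`
    have ht2pos : 0 < t ^ 2 := by rw [← sq_abs]; positivity
    have h4 : (max 1 A / |t|) ^ (m + 1) ≤ max 1 A ^ (m + 1) / t ^ 2 := by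
      rw [div_pow]
      refine div_le_div_of_nonneg_left (by positivity) ht2pos ?_
      calc t ^ 2 = |t| ^ 2 := (sq_abs t).symm
        _ ≤ |t| ^ (m + 1) := pow_le_pow_right₀ ht.le (by omega)
    have h5 : max 1 A ^ (m + 1) / t ^ 2 ≤ 2 * max 1 A ^ (m + 1) / (1 + t ^ 2) := by
      rw [div_le_div_iff₀ (by positivity) (by positivity)]
      have : 1 + t ^ 2 ≤ 2 * t ^ 2 := by nlinarith [sq_abs t]
      have hp : 0 ≤ max 1 A ^ (m + 1) := by positivity
      nlinarith
    calc ‖laplaceFactor A (σ + t * I) ^ (m + 1)‖ ≤ (A / ‖(σ : ℂ) + t * I‖) ^ (m + 1) * E := h2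
      _ ≤ (2 * max 1 A ^ (m + 1) / (1 + t ^ 2)) * E :=
          mul_le_mul_of_nonneg_right (h3.trans (h4.trans h5)) (by positivity)
      _ = 2 * E * max 1 A ^ (m + 1) / (1 + t ^ 2) := by ring

/-- `t ↦ Ψ̂(σ+it)` is integrable (`m ≥ 1`). [folklore] -/
theorem integrable_laplaceFactor_pow_vertical (hA : 0 < A) {m : ℕ} (hm : 1 ≤ m) (σ : ℝ) :
    Integrable fun t : ℝ ↦ laplaceFactor A (σ + t * I) ^ (m + 1) := by
  have hc : Continuous fun t : ℝ ↦ laplaceFactor A (σ + t * I) ^ (m + 1) :=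
    ((differentiable_laplaceFactor hA).continuous.comp (by fun_prop)).pow _
  refine Integrable.mono' ((integrable_inv_one_add_sq).const_mul
    (2 * Real.exp ((m + 1) * |σ| / A) * max 1 A ^ (m + 1))) hc.aestronglyMeasurable
    (Eventually.of_forall fun t ↦ ?_)
  have := norm_laplaceFactor_pow_vertical_le hA hm σ t
  rwa [div_eq_mul_inv] at this

/-! ### Inversion on a vertical line -/

/-- The Fourier transform of `φ_{m+1}(w) e^{σw}` is `Ψ̂(σ − 2πiξ)`. [folklore] -/
theorem fourier_phi_mul_exp (hA : 0 < A) (m : ℕ) (σ ξ : ℝ) :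
    𝓕 (fun w : ℝ ↦ (phi A m w : ℂ) * Complex.exp (σ * w)) ξ =
      laplaceFactor A (σ + (-(2 * π * ξ) : ℝ) * I) ^ (m + 1) := by
  rw [Real.fourier_real_eq_integral_exp_smul]
  simp only [smul_eq_mul]
  have e : ∀ v : ℝ, Complex.exp (↑(-2 * π * v * ξ) * I) * ((phi A m v : ℂ) * Complex.exp (σ * v)) =
      (phi A m v : ℂ) * Complex.exp (((σ : ℂ) + (-(2 * π * ξ) : ℝ) * I) * v) := by
    intro v
    rw [show Complex.exp (((σ : ℂ) + (-(2 * π * ξ) : ℝ) * I) * v) =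
      Complex.exp (↑(-2 * π * v * ξ) * I) * Complex.exp (σ * v) by
        rw [← Complex.exp_add]; push_cast; ring_nf]
    ring
  simp_rw [e]
  exact integral_phi_mul_exp hA _ m

/-- **Inversion on the line `Re s = σ`** (`m ≥ 1`): for every real `w`,
`φ_{m+1}(w) = (1/2π) ∫ e^{−w(σ+it)} Ψ̂(σ+it) dt` (Fourier inversion for the continuous integrable
`φ(w)e^{σw}`, whose transform `Ψ̂(σ − 2πiξ)` is integrable; then `t = −2πξ`). This is Mellin
inversion for `Ψ(y) = φ(log y)` on the line `Re s = σ`. [cite: ThornerZaman2017, Lemma 4.3 (ii)] -/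
theorem phi_eq_integral (hA : 0 < A) {m : ℕ} (hm : 1 ≤ m) (σ w : ℝ) :
    (phi A m w : ℂ) = (1 / (2 * π) : ℝ) *
      ∫ t : ℝ, Complex.exp (-(w : ℂ) * (σ + t * I)) * laplaceFactor A (σ + t * I) ^ (m + 1) := by
  set g : ℝ → ℂ := fun w ↦ (phi A m w : ℂ) * Complex.exp (σ * w) with hg
  have hgi : Integrable g := integrable_phi_mul_exp hA m σ
  have hgc : Continuous g :=
    (Complex.continuous_ofReal.comp (continuous_phi hA m hm)).mul (by fun_prop)
  have hFg : 𝓕 g = fun ξ : ℝ ↦ laplaceFactor A (σ + (-(2 * π * ξ) : ℝ) * I) ^ (m + 1) :=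
    funext (fourier_phi_mul_exp hA m σ)
  have hFi : Integrable (𝓕 g) := by
    rw [hFg]
    have h := (integrable_laplaceFactor_pow_vertical hA hm σ).comp_mul_left' (R := -(2 * π))
      (neg_ne_zero.mpr (by positivity))
    exact h.congr (Eventually.of_forall fun ξ ↦ by simp)
  have hinv := congrFun (hgc.fourierInv_fourier_eq hgi hFi) w
  -- `g(w) = ∫ e^{2πiwξ} Ψ̂(σ − 2πiξ) dξ = (1/2π) ∫ e^{−iwt} Ψ̂(σ + it) dt`
  rw [Real.fourierInv_eq'] at hinv
  simp only [RCLike.inner_apply', conj_trivial, smul_eq_mul, hFg] at hinv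
  have hπ : 0 < 2 * π := by positivity
  set J : ℂ := ∫ t : ℝ, Complex.exp (-(w : ℂ) * (t * I)) * laplaceFactor A (σ + t * I) ^ (m + 1) with hJ
  have hsub : ∫ ξ : ℝ, Complex.exp (↑(2 * π * (ξ * w)) * I) *
      laplaceFactor A (σ + (-(2 * π * ξ) : ℝ) * I) ^ (m + 1) = ((2 * π)⁻¹ : ℝ) • J := by
    have h := Measure.integral_comp_mul_left
      (fun t : ℝ ↦ Complex.exp (-(w : ℂ) * (t * I)) * laplaceFactor A (σ + t * I) ^ (m + 1)) (-(2 * π))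
    rw [abs_inv, abs_neg, abs_of_pos hπ] at h
    rw [hJ, ← h]
    refine integral_congr_ae (Eventually.of_forall fun ξ ↦ ?_)
    simp only
    congr 1
    · congr 1; push_cast; ring
    · congr 2; push_cast; ring
  rw [hsub] at hinv
  -- `φ(w) = (φ(w) e^{σw}) e^{−σw}`
  have hg' : g w = (phi A m w : ℂ) * Complex.exp (σ * w) := rfl
  calc (phi A m w : ℂ) = (phi A m w : ℂ) * Complex.exp (σ * w) * Complex.exp (-(σ * w)) := by
        rw [mul_assoc, ← Complex.exp_add, add_neg_cancel, Complex.exp_zero, mul_one]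
    _ = (((2 * π)⁻¹ : ℝ) • J) * Complex.exp (-(σ * w)) := by rw [← hg', ← hinv]
    _ = (1 / (2 * π) : ℝ) * (J * Complex.exp (-(σ * w))) := by rw [Complex.real_smul, one_div, mul_assoc]
    _ = _ := by
        rw [hJ, ← MeasureTheory.integral_mul_const]
        congr 1
        refine integral_congr_ae (Eventually.of_forall fun t ↦ ?_)
        simp only
        rw [show -(w : ℂ) * (σ + t * I) = -(w : ℂ) * (t * I) + -((σ : ℂ) * w) by ring, Complex.exp_add]
        ring

end Literature.NumberTheory.LFunctions.WeissKernel


/-! ## Smoothed Dirichlet series: `Σ a(n) n^{−1} φ(u − log n)` as a vertical integral -/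

namespace Literature.NumberTheory.LFunctions.WeissKernel

variable {A : ℝ}

/-- **The smoothed sum** `S_a(u) = Σ_{n ≥ 1} a(n) n^{−1} φ_{m+1}(u − log n)` of a Dirichlet series
with Weiss's kernel (`= Σ a(n) n^{−1} Ψ(x/n)`, `x = e^u`; the term `n = 0` vanishes).
[cite: ThornerZaman2017, Lemma 4.4] -/
def smoothedSum (a : ℕ → ℂ) (A : ℝ) (m : ℕ) (u : ℝ) : ℂ :=
  ∑' n : ℕ, a n * (n : ℂ)⁻¹ * (phi A m (u - Real.log n) : ℂ)

/-- `n^{−1} e^{s log n} = 1/n^{1−s}`, i.e. the term of the `L`-series at `1 − s`. [folklore] -/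
theorem term_one_sub_eq (a : ℕ → ℂ) (s : ℂ) (n : ℕ) :
    LSeries.term a (1 - s) n = a n * (n : ℂ)⁻¹ * Complex.exp ((Real.log n : ℂ) * s) := by
  rcases eq_or_ne n 0 with rfl | hn
  · simp [LSeries.term]
  · have hn' : (n : ℂ) ≠ 0 := by exact_mod_cast hn
    rw [LSeries.term, if_neg hn, Complex.cpow_def_of_ne_zero hn', ← Complex.natCast_log,
      div_eq_mul_inv, ← Complex.exp_neg]
    rw [show -((Real.log n : ℂ) * (1 - s)) = -(Real.log n : ℂ) + (Real.log n : ℂ) * s by ring,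
      Complex.exp_add, Complex.exp_neg, Complex.natCast_log, Complex.exp_log hn']
    ring

/-- **The smoothed sum as a vertical integral to the LEFT of `0`**: for `c > 0` with
`Σ |a(n)| n^{−1−c} < ∞`, `m ≥ 1` and every real `u`,
`S_a(u) = (1/2π) ∫ e^{−us} Ψ̂(s) L(a, 1 − s) dt`, `s = −c + it`
(insert `phi_eq_integral` term by term and interchange sum and integral, the double sum-integral
converging absolutely). [cite: ThornerZaman2017, Lemma 4.4] -/
theorem smoothedSum_eq_integral (hA : 0 < A) {m : ℕ} (hm : 1 ≤ m) (c : ℝ)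
    {a : ℕ → ℂ} (ha : LSeriesSummable a (1 + c)) (u : ℝ) :
    smoothedSum a A m u = (1 / (2 * π) : ℝ) *
      ∫ t : ℝ, Complex.exp (-(u : ℂ) * ((-c : ℝ) + t * I)) *
        laplaceFactor A ((-c : ℝ) + t * I) ^ (m + 1) * LSeries a (1 - ((-c : ℝ) + t * I)) := by
  set sv : ℝ → ℂ := fun t ↦ ((-c : ℝ) : ℂ) + t * I with hsv
  set Λk : ℝ → ℂ := fun t ↦ laplaceFactor A (sv t) ^ (m + 1) with hΛk
  have hΛi : Integrable Λk := integrable_laplaceFactor_pow_vertical hA hm (-c)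
  set MΛ : ℝ := ∫ t, ‖Λk t‖ with hMΛ
  -- the pieces
  set F : ℕ → ℝ → ℂ := fun n t ↦ (1 / (2 * π) : ℝ) *
    (a n * (n : ℂ)⁻¹ * (Complex.exp (-((u - Real.log n : ℝ) : ℂ) * sv t) * Λk t)) with hF
  -- (i) each term of `S_a` is `∫ F n`
  have hterm : ∀ n : ℕ, a n * (n : ℂ)⁻¹ * (phi A m (u - Real.log n) : ℂ) = ∫ t, F n t := by
    intro n
    rw [phi_eq_integral hA hm (-c) (u - Real.log n), hF]
    simp only [hsv, hΛk]
    rw [MeasureTheory.integral_const_mul, MeasureTheory.integral_const_mul]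
    push_cast
    ring
  -- norms of the twist
  have hnormexp : ∀ (w t : ℝ), ‖Complex.exp (-(w : ℂ) * sv t)‖ = Real.exp (w * c) := by
    intro w t
    rw [Complex.norm_exp]
    congr 1
    simp [hsv]
  -- (ii) integrability of each `F n`
  have hFi : ∀ n, Integrable (F n) := by
    intro n
    refine Integrable.const_mul (Integrable.const_mul ?_ _) _
    refine Integrable.bdd_mul (c := Real.exp ((u - Real.log n) * c)) hΛi
      (Continuous.aestronglyMeasurable (by fun_prop)) (Eventually.of_forall fun t ↦ ?_)
    exact (hnormexp _ t).le
  -- (iii) `Σ ∫ |F n| < ∞`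
  have hFnorm : ∀ n, ∫ t, ‖F n t‖ = (1 / (2 * π)) * (‖a n‖ * ‖(n : ℂ)⁻¹‖ *
      Real.exp ((u - Real.log n) * c)) * MΛ := by
    intro n
    have e : ∀ t, ‖F n t‖ = (1 / (2 * π)) * (‖a n‖ * ‖(n : ℂ)⁻¹‖ * Real.exp ((u - Real.log n) * c)) * ‖Λk t‖ := by
      intro t
      rw [hF]; dsimp only
      rw [norm_mul, norm_mul, norm_mul, norm_mul, hnormexp, Complex.norm_real, Real.norm_eq_abs,
        abs_of_pos (by positivity)]
      ring
    simp_rw [e]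
    rw [MeasureTheory.integral_const_mul, hMΛ]
  have hsum : Summable fun n ↦ ∫ t, ‖F n t‖ := by
    simp_rw [hFnorm]
    refine Summable.mul_right _ (Summable.mul_left _ ?_)
    -- compare with the terms of `L(a, 1 + c)`
    have hs := ha.norm
    refine Summable.of_nonneg_of_le (fun n ↦ by positivity) (fun n ↦ ?_) (hs.mul_left (Real.exp (u * c)))
    rw [LSeries.norm_term_eq]
    rcases eq_or_ne n 0 with rfl | hn
    · simp
    · rw [if_neg hn, norm_inv, Complex.norm_natCast]
      have hn0 : (0 : ℝ) < n := by exact_mod_cast Nat.pos_of_ne_zero hn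
      have hre : (1 + (c : ℂ)).re = 1 + c := by simp
      rw [hre, Real.rpow_add hn0, Real.rpow_one, show (u - Real.log n) * c = u * c + -(Real.log n * c) by ring,
        Real.exp_add, show Real.exp (-(Real.log n * c)) = (n : ℝ) ^ (-c) by
          rw [Real.rpow_def_of_pos hn0]; ring_nf, Real.rpow_neg hn0.le]
      field_simp
      exact le_refl _
  -- (iv) the pointwise sum
  have hinner : ∀ t : ℝ, ∑' n, F n t = (1 / (2 * π) : ℝ) *
      (Complex.exp (-(u : ℂ) * sv t) * Λk t * LSeries a (1 - sv t)) := by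
    intro t
    rw [LSeries, ← tsum_mul_left, ← tsum_mul_left]
    refine tsum_congr fun n ↦ ?_
    rw [hF, term_one_sub_eq]
    dsimp only
    rw [show Complex.exp (-((u - Real.log n : ℝ) : ℂ) * sv t) =
      Complex.exp (-(u : ℂ) * sv t) * Complex.exp ((Real.log n : ℂ) * sv t) by
        rw [← Complex.exp_add]; push_cast; ring_nf]
    ring
  -- assemble
  rw [smoothedSum]
  simp_rw [hterm]
  rw [integral_tsum_of_summable_integral_norm hFi hsum]
  simp_rw [hinner]
  rw [MeasureTheory.integral_const_mul]

/-! ### The majorant on the strip `|Re s| ≤ 3/2` -/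

/-- The constant of the majorant: `C = 2 e^{3(m+1)/(2A)} (11/2)^N (1 + max(1,A))^{m+N+3}`.
[cite: ThornerZaman2017, Lemma 4.4] -/
def majorConst (A : ℝ) (m N : ℕ) : ℝ :=
  2 * Real.exp (3 * (m + 1) / (2 * A)) * (11 / 2) ^ N * (1 + max 1 A) ^ (m + N + 3)

/-- `0 < C`. [folklore] -/
theorem majorConst_pos (A : ℝ) (m N : ℕ) : 0 < majorConst A m N := by
  unfold majorConst; positivity

/-- **The majorant**: for `|Re s| ≤ 3/2` and `m ≥ N + 2`,
`|Ψ̂(s)| (9/2 + |Im s|)^N ≤ C/(1 + (Im s)²)` (`|Ψ̂| ≤ e^{k|σ|/A}` for `|t| ≤ max(1,A)`, and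
`|Ψ̂| ≤ (A/|t|)^k e^{k|σ|/A}`, `k = m+1 ≥ N+3`, beyond). [cite: ThornerZaman2017, Lemma 4.3 (iii)] -/
theorem norm_laplaceFactor_pow_mul_le (hA : 0 < A) {m N : ℕ} (hNm : N + 2 ≤ m) {σ : ℝ}
    (hσ : |σ| ≤ 3 / 2) (t : ℝ) :
    ‖laplaceFactor A (σ + t * I) ^ (m + 1)‖ * (9 / 2 + |t|) ^ N ≤ majorConst A m N / (1 + t ^ 2) := by
  set B : ℝ := max 1 A with hB
  set E : ℝ := Real.exp (3 * (m + 1) / (2 * A)) with hE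
  have hB1 : 1 ≤ B := le_max_left _ _
  have hBA : A ≤ B := le_max_right _ _
  have hB0 : 0 < B := by linarith
  have hre : ((σ : ℂ) + t * I).re = σ := by simp
  -- `e^{k|σ|/A} ≤ E`
  have hexpE : Real.exp ((m + 1 : ℕ) * |((σ : ℂ) + t * I).re| / A) ≤ E := by
    rw [hre, hE]
    refine Real.exp_le_exp.mpr ?_
    rw [div_le_div_iff₀ hA (by positivity)]
    push_cast
    have h : ((m : ℝ) + 1) * |σ| ≤ ((m : ℝ) + 1) * (3 / 2) := mul_le_mul_of_nonneg_left hσ (by positivity)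
    nlinarith [h, hA.le]
  have hC : majorConst A m N = 2 * E * (11 / 2) ^ N * (1 + B) ^ (m + N + 3) := by
    rw [majorConst, hE, hB]
  rw [hC]
  have hpowB : ∀ j : ℕ, j ≤ m + N + 3 → B ^ j ≤ (1 + B) ^ (m + N + 3) := fun j hj ↦
    (pow_le_pow_left₀ hB0.le (by linarith) j).trans (pow_le_pow_right₀ (by linarith) hj)
  by_cases ht : |t| ≤ B
  · -- small `|t|`
    have h1 : ‖laplaceFactor A (σ + t * I) ^ (m + 1)‖ ≤ E :=
      (norm_laplaceFactor_pow_le_exp hA _ _).trans hexpE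
    have h2 : (9 / 2 + |t|) ^ N ≤ (11 / 2) ^ N * (1 + B) ^ N := by
      rw [← mul_pow]
      exact pow_le_pow_left₀ (by positivity) (by nlinarith [abs_nonneg t]) N
    have h3 : 1 + t ^ 2 ≤ (1 + B) ^ 2 := by
      have : t ^ 2 ≤ B ^ 2 := by rw [← sq_abs]; exact pow_le_pow_left₀ (abs_nonneg t) ht 2
      nlinarith
    rw [le_div_iff₀ (by positivity)]
    calc ‖laplaceFactor A (σ + t * I) ^ (m + 1)‖ * (9 / 2 + |t|) ^ N * (1 + t ^ 2)
        ≤ E * ((11 / 2) ^ N * (1 + B) ^ N) * (1 + B) ^ 2 := by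
          refine mul_le_mul (mul_le_mul h1 h2 (by positivity) (by positivity)) h3 (by positivity)
            (by positivity)
      _ = E * (11 / 2) ^ N * (1 + B) ^ (N + 2) := by ring
      _ ≤ 2 * E * (11 / 2) ^ N * (1 + B) ^ (m + N + 3) := by
          have h4 : (1 + B) ^ (N + 2) ≤ (1 + B) ^ (m + N + 3) :=
            pow_le_pow_right₀ (by linarith) (by omega)
          have h5 : 0 ≤ E * (11 / 2 : ℝ) ^ N := by positivity
          nlinarith [h4, h5, pow_nonneg (by linarith : (0 : ℝ) ≤ 1 + B) (m + N + 3)]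
  · -- large `|t|`
    rw [not_le] at ht
    have ht1 : 1 < |t| := lt_of_le_of_lt hB1 ht
    have ht0 : 0 < |t| := by linarith
    have hs0 : (σ : ℂ) + t * I ≠ 0 := by
      intro h; have := congrArg Complex.im h; simp at this; rw [this] at ht1; norm_num at ht1
    have hst : |t| ≤ ‖(σ : ℂ) + t * I‖ := by
      have := Complex.abs_im_le_norm ((σ : ℂ) + t * I); simpa using this
    have h1 : ‖laplaceFactor A (σ + t * I) ^ (m + 1)‖ ≤ (B / |t|) ^ (m + 1) * E := by
      refine (norm_laplaceFactor_pow_le_div hA hs0 (m + 1)).trans ?_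
      refine mul_le_mul ?_ hexpE (by positivity) (by positivity)
      exact pow_le_pow_left₀ (by positivity) (div_le_div₀ hB0.le hBA ht0 hst) _
    have h2 : (9 / 2 + |t|) ^ N ≤ (11 / 2) ^ N * |t| ^ N := by
      rw [← mul_pow]
      exact pow_le_pow_left₀ (by positivity) (by nlinarith) N
    -- `|t|^{N} / |t|^{m+1} ≤ 1/t²`
    have ht2 : 0 < t ^ 2 := by rw [← sq_abs]; exact pow_pos ht0 2
    have h3 : |t| ^ N / |t| ^ (m + 1) ≤ 1 / t ^ 2 := by
      rw [div_le_div_iff₀ (pow_pos ht0 _) ht2, one_mul, ← sq_abs, ← pow_add]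
      exact pow_le_pow_right₀ ht1.le (by omega)
    have h4 : 1 / t ^ 2 ≤ 2 / (1 + t ^ 2) := by
      rw [div_le_div_iff₀ (by positivity) (by positivity)]
      nlinarith [sq_abs t]
    calc ‖laplaceFactor A (σ + t * I) ^ (m + 1)‖ * (9 / 2 + |t|) ^ N
        ≤ ((B / |t|) ^ (m + 1) * E) * ((11 / 2) ^ N * |t| ^ N) :=
          mul_le_mul h1 h2 (by positivity) (by positivity)
      _ = E * (11 / 2) ^ N * B ^ (m + 1) * (|t| ^ N / |t| ^ (m + 1)) := by
          rw [div_pow]; ring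
      _ ≤ E * (11 / 2) ^ N * (1 + B) ^ (m + N + 3) * (2 / (1 + t ^ 2)) := by
          refine mul_le_mul (mul_le_mul_of_nonneg_left (hpowB (m + 1) (by omega)) (by positivity))
            (h3.trans h4) (by positivity) (by positivity)
      _ = 2 * E * (11 / 2) ^ N * (1 + B) ^ (m + N + 3) / (1 + t ^ 2) := by ring

/-! ### Moving the line to `Re s = 3/2` across the pole at `s = 0` -/

/-- **The smoothed sum with the main term extracted**: let `a` have `Σ|a(n)|n^{−1−c} < ∞`
(`0 < c ≤ 1`) and `L(a, z) = F(z)/(z − 1)` on `Re z > 1` for an entire `F` with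
`|F(z)| ≤ M |z + 5/2|^N` on `Re z ≥ −1/2`; let `m ≥ N + 2`. Then for every real `u`
`S_a(u) = F(1) + (1/2π) ∫ e^{−us} Ψ̂(s) F(1 − s)/(−s) dt`, `s = 3/2 + it`
(the line `Re s = −c` of `smoothedSum_eq_integral` moved to `Re s = 3/2` across the simple pole of
`L(a, 1 − s) = −F(1 − s)/s` at `s = 0`, residue `−F(1)`: the tree's
`Montgomery.integral_vertical_div_sub_eq`). [cite: ThornerZaman2017, Lemma 4.4] -/
theorem smoothedSum_eq_add_integral (hA : 0 < A) {m N : ℕ} (hNm : N + 2 ≤ m) {c : ℝ} (hc : 0 < c)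
    (hc1 : c ≤ 1) {a : ℕ → ℂ} (ha : LSeriesSummable a (1 + c)) {F : ℂ → ℂ} (hF : Differentiable ℂ F)
    (hLF : ∀ z : ℂ, 1 < z.re → LSeries a z = F z / (z - 1)) {M : ℝ} (hM : 0 ≤ M)
    (hbd : ∀ z : ℂ, -1 / 2 ≤ z.re → ‖F z‖ ≤ M * ‖z + 5 / 2‖ ^ N) (u : ℝ) :
    smoothedSum a A m u = F 1 + (1 / (2 * π) : ℝ) *
      ∫ t : ℝ, Complex.exp (-(u : ℂ) * ((3 / 2 : ℝ) + t * I)) *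
        laplaceFactor A ((3 / 2 : ℝ) + t * I) ^ (m + 1) * (F (1 - ((3 / 2 : ℝ) + t * I)) / (-((3 / 2 : ℝ) + t * I))) := by
  have hm1 : 1 ≤ m := by omega
  set g : ℂ → ℂ := fun s ↦ -(Complex.exp (-(u : ℂ) * s) * laplaceFactor A s ^ (m + 1) * F (1 - s)) with hg
  set Kc : ℝ := Real.exp (3 / 2 * |u|) * M * majorConst A m N with hKc
  have hKc0 : 0 ≤ Kc := mul_nonneg (mul_nonneg (Real.exp_pos _).le hM) (majorConst_pos _ _ _).le
  -- the majorant on the closed strip `[-c, 3/2]`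
  have hmajor : ∀ σ ∈ Icc (-c) (3 / 2), ∀ t : ℝ, ‖g (σ + t * I)‖ ≤ Kc / (1 + t ^ 2) := by
    intro σ hσ t
    obtain ⟨hσ1, hσ2⟩ := hσ
    have hσabs : |σ| ≤ 3 / 2 := abs_le.mpr ⟨by linarith, hσ2⟩
    rw [hg]; dsimp only
    rw [norm_neg, norm_mul, norm_mul]
    -- the three factors
    have h1 : ‖Complex.exp (-(u : ℂ) * (σ + t * I))‖ ≤ Real.exp (3 / 2 * |u|) := by
      rw [Complex.norm_exp]
      refine Real.exp_le_exp.mpr ?_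
      have : (-(u : ℂ) * (σ + t * I)).re = -(u * σ) := by simp
      rw [this]
      calc -(u * σ) ≤ |u * σ| := neg_le_abs _
        _ = |u| * |σ| := abs_mul _ _
        _ ≤ |u| * (3 / 2) := mul_le_mul_of_nonneg_left hσabs (abs_nonneg _)
        _ = 3 / 2 * |u| := by ring
    have h2 : ‖F (1 - (σ + t * I))‖ ≤ M * (9 / 2 + |t|) ^ N := by
      refine (hbd _ (by simp; linarith)).trans (mul_le_mul_of_nonneg_left ?_ hM)
      refine pow_le_pow_left₀ (norm_nonneg _) ?_ N
      have e : (1 : ℂ) - (σ + t * I) + 5 / 2 = ((7 / 2 - σ : ℝ) : ℂ) + (-t) * I := by push_cast; ring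
      rw [e]
      refine (norm_add_le _ _).trans ?_
      rw [Complex.norm_real, norm_mul, Complex.norm_I, mul_one, norm_neg, Complex.norm_real,
        Real.norm_eq_abs, Real.norm_eq_abs, abs_of_pos (by linarith)]
      linarith
    have h3 := norm_laplaceFactor_pow_mul_le hA hNm hσabs t
    calc ‖Complex.exp (-(u : ℂ) * (σ + t * I))‖ * ‖laplaceFactor A (σ + t * I) ^ (m + 1)‖ *
          ‖F (1 - (σ + t * I))‖
        ≤ Real.exp (3 / 2 * |u|) * ‖laplaceFactor A (σ + t * I) ^ (m + 1)‖ * (M * (9 / 2 + |t|) ^ N) :=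
          mul_le_mul (mul_le_mul_of_nonneg_right h1 (norm_nonneg _)) h2 (norm_nonneg _) (by positivity)
      _ = Real.exp (3 / 2 * |u|) * M * (‖laplaceFactor A (σ + t * I) ^ (m + 1)‖ * (9 / 2 + |t|) ^ N) := by
          ring
      _ ≤ Real.exp (3 / 2 * |u|) * M * (majorConst A m N / (1 + t ^ 2)) :=
          mul_le_mul_of_nonneg_left h3 (by positivity)
      _ = Kc / (1 + t ^ 2) := by rw [hKc]; ring
  -- continuity of `g` along lines and differentiability
  have hgd : Differentiable ℂ g := by
    rw [hg]
    refine ((Differentiable.mul (Differentiable.mul ?_ ((differentiable_laplaceFactor hA).pow _)) ?_)).neg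
    · fun_prop
    · exact hF.comp (by fun_prop)
  have hne : ∀ {σ : ℝ}, σ ≠ 0 → ∀ t : ℝ, (σ : ℂ) + t * I - 0 ≠ 0 := by
    intro σ hσ t h
    have := congrArg Complex.re h
    simp at this
    exact hσ this
  have hgline : ∀ {σ : ℝ}, σ ≠ 0 → Continuous fun t : ℝ ↦ g (σ + t * I) / (σ + t * I - 0) := by
    intro σ hσ
    exact (hgd.continuous.comp (by fun_prop)).div (by fun_prop) (hne hσ)
  -- integrability on a line `Re s = σ ∈ [-c, 3/2]`, `σ ≠ 0`
  have hint : ∀ {σ : ℝ}, σ ∈ Icc (-c) (3 / 2) → σ ≠ 0 →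
      Integrable fun t : ℝ ↦ g (σ + t * I) / (σ + t * I - 0) := by
    intro σ hσ hσ0
    refine Integrable.mono' ((integrable_inv_one_add_sq).const_mul (Kc / |σ|)) (hgline hσ0).aestronglyMeasurable
      (Eventually.of_forall fun t ↦ ?_)
    rw [norm_div, sub_zero]
    have hsn : |σ| ≤ ‖(σ : ℂ) + t * I‖ := by
      have := Complex.abs_re_le_norm ((σ : ℂ) + t * I); simpa using this
    have hσpos : 0 < |σ| := abs_pos.mpr hσ0
    calc ‖g (σ + t * I)‖ / ‖(σ : ℂ) + t * I‖ ≤ (Kc / (1 + t ^ 2)) / |σ| :=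
          div_le_div₀ (by positivity) (hmajor σ hσ t) hσpos hsn
      _ = Kc / |σ| * (1 + t ^ 2)⁻¹ := by rw [div_div, div_eq_mul_inv, mul_inv, ← mul_assoc, div_eq_mul_inv]; ring
  -- decay on horizontal segments
  have hdecay : ∀ ε : ℝ, 0 < ε → ∃ T₀ : ℝ, ∀ T : ℝ, T₀ ≤ |T| → ∀ x ∈ Icc (-c) (3 / 2),
      ‖g (x + T * I) / (x + T * I - 0)‖ ≤ ε := by
    intro ε hε
    refine ⟨max 1 (Kc / ε + 1), fun T hT x hx ↦ ?_⟩
    have hT1 : 1 ≤ |T| := le_trans (le_max_left _ _) hT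
    have hT2 : Kc / ε + 1 ≤ |T| := le_trans (le_max_right _ _) hT
    rw [norm_div, sub_zero]
    have hTn : |T| ≤ ‖(x : ℂ) + T * I‖ := by
      have := Complex.abs_im_le_norm ((x : ℂ) + T * I); simpa using this
    have h1 : ‖g (x + T * I)‖ / ‖(x : ℂ) + T * I‖ ≤ Kc / |T| := by
      calc ‖g (x + T * I)‖ / ‖(x : ℂ) + T * I‖ ≤ (Kc / (1 + T ^ 2)) / |T| :=
            div_le_div₀ (by positivity) (hmajor x hx T) (by linarith) hTn
        _ ≤ Kc / |T| := by
            refine div_le_div_of_nonneg_right ?_ (by linarith)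
            exact div_le_self hKc0 (by nlinarith)
    refine h1.trans ?_
    rcases eq_or_lt_of_le hKc0 with h0 | hpos
    · rw [← h0, zero_div]; exact hε.le
    · calc Kc / |T| ≤ Kc / (Kc / ε) := div_le_div_of_nonneg_left hKc0 (by positivity) (by linarith)
        _ = ε := by field_simp
  -- the pole shift
  have hcI : (-c : ℝ) ∈ Icc (-c) (3 / 2) := ⟨le_rfl, by linarith⟩
  have hbI : (3 / 2 : ℝ) ∈ Icc (-c) (3 / 2) := ⟨by linarith, le_rfl⟩
  have hshift := Montgomery.integral_vertical_div_sub_eq (g := g) (a := -c) (b := 3 / 2) (p := 0)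
    (by simpa using hc) (by norm_num) hgd.differentiableOn (hint hcI (by linarith))
    (hint hbI (by norm_num)) hdecay
  -- `g(0) = -F(1)`
  have hg0 : g 0 = -F 1 := by
    rw [hg]; simp [laplaceFactor]
  -- the left line is `2π S_a(u)`
  have hleft : ∀ t : ℝ, g ((-c : ℝ) + t * I) / ((-c : ℝ) + t * I - 0) =
      Complex.exp (-(u : ℂ) * ((-c : ℝ) + t * I)) * laplaceFactor A ((-c : ℝ) + t * I) ^ (m + 1) *
        LSeries a (1 - ((-c : ℝ) + t * I)) := by
    intro t
    have hs0 : ((-c : ℝ) : ℂ) + t * I ≠ 0 := by simpa using hne (σ := -c) (by linarith) t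
    rw [hLF _ (by simp; linarith), hg, sub_zero]
    dsimp only
    rw [show (1 : ℂ) - ((-c : ℝ) + t * I) - 1 = -(((-c : ℝ) : ℂ) + t * I) by ring]
    field_simp
  have hright : ∀ t : ℝ, g ((3 / 2 : ℝ) + t * I) / ((3 / 2 : ℝ) + t * I - 0) =
      Complex.exp (-(u : ℂ) * ((3 / 2 : ℝ) + t * I)) * laplaceFactor A ((3 / 2 : ℝ) + t * I) ^ (m + 1) *
        (F (1 - ((3 / 2 : ℝ) + t * I)) / (-((3 / 2 : ℝ) + t * I))) := by
    intro t
    have hs0 : ((3 / 2 : ℝ) : ℂ) + t * I ≠ 0 := by simpa using hne (σ := 3 / 2) (by norm_num) t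
    rw [hg, sub_zero]
    dsimp only
    field_simp
  simp_rw [hleft, hright, hg0] at hshift
  rw [smoothedSum_eq_integral hA hm1 c ha u]
  set L := ∫ t : ℝ, Complex.exp (-(u : ℂ) * ((-c : ℝ) + t * I)) *
    laplaceFactor A ((-c : ℝ) + t * I) ^ (m + 1) * LSeries a (1 - ((-c : ℝ) + t * I)) with hL
  set R := ∫ t : ℝ, Complex.exp (-(u : ℂ) * ((3 / 2 : ℝ) + t * I)) *
    laplaceFactor A ((3 / 2 : ℝ) + t * I) ^ (m + 1) *
      (F (1 - ((3 / 2 : ℝ) + t * I)) / (-((3 / 2 : ℝ) + t * I))) with hR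
  have hLR : L = R + 2 * π * F 1 := by
    have h : I * L = I * (R + 2 * π * F 1) := by linear_combination -hshift
    exact mul_left_cancel₀ Complex.I_ne_zero h
  rw [hLR]
  push_cast
  field_simp
  ring

/-- **The bound for the smoothed sum** (abstract Thorner–Zaman Lemma 4.4): under the hypotheses
of `smoothedSum_eq_add_integral`,
`|S_a(u) − F(1)| ≤ (1/3) M C e^{−3u/2}`, `C = majorConst A m N` (on `Re s = 3/2`:
`|e^{−us}| = e^{−3u/2}`, `|Ψ̂(s)||F(1−s)| ≤ M C/(1+t²)`, `|1/s| ≤ 2/3`, `∫ dt/(1+t²) = π`).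
[cite: ThornerZaman2017, Lemma 4.4] -/
theorem norm_smoothedSum_sub_le (hA : 0 < A) {m N : ℕ} (hNm : N + 2 ≤ m) {c : ℝ} (hc : 0 < c)
    (hc1 : c ≤ 1) {a : ℕ → ℂ} (ha : LSeriesSummable a (1 + c)) {F : ℂ → ℂ} (hF : Differentiable ℂ F)
    (hLF : ∀ z : ℂ, 1 < z.re → LSeries a z = F z / (z - 1)) {M : ℝ} (hM : 0 ≤ M)
    (hbd : ∀ z : ℂ, -1 / 2 ≤ z.re → ‖F z‖ ≤ M * ‖z + 5 / 2‖ ^ N) (u : ℝ) :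
    ‖smoothedSum a A m u - F 1‖ ≤ 1 / 3 * M * majorConst A m N * Real.exp (-(3 / 2 * u)) := by
  rw [smoothedSum_eq_add_integral hA hNm hc hc1 ha hF hLF hM hbd u, add_sub_cancel_left, norm_mul,
    Complex.norm_real, Real.norm_eq_abs, abs_of_pos (by positivity)]
  set C := majorConst A m N with hC
  have hC0 : 0 < C := majorConst_pos A m N
  -- pointwise bound on `Re s = 3/2`
  have hpt : ∀ t : ℝ, ‖Complex.exp (-(u : ℂ) * ((3 / 2 : ℝ) + t * I)) *
      laplaceFactor A ((3 / 2 : ℝ) + t * I) ^ (m + 1) *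
        (F (1 - ((3 / 2 : ℝ) + t * I)) / (-((3 / 2 : ℝ) + t * I)))‖ ≤
      (2 / 3 * Real.exp (-(3 / 2 * u)) * M * C) * (1 + t ^ 2)⁻¹ := by
    intro t
    rw [norm_mul, norm_mul, norm_div, norm_neg]
    have h1 : ‖Complex.exp (-(u : ℂ) * ((3 / 2 : ℝ) + t * I))‖ = Real.exp (-(3 / 2 * u)) := by
      rw [Complex.norm_exp]; congr 1; simp; ring
    have h2 : ‖F (1 - ((3 / 2 : ℝ) + t * I))‖ ≤ M * (9 / 2 + |t|) ^ N := by
      refine (hbd _ (by simp; norm_num)).trans (mul_le_mul_of_nonneg_left ?_ hM)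
      refine pow_le_pow_left₀ (norm_nonneg _) ?_ N
      have e : (1 : ℂ) - ((3 / 2 : ℝ) + t * I) + 5 / 2 = (2 : ℝ) + (-t) * I := by push_cast; ring
      rw [e]
      refine (norm_add_le _ _).trans ?_
      rw [Complex.norm_real, norm_mul, Complex.norm_I, mul_one, norm_neg, Complex.norm_real,
        Real.norm_eq_abs, Real.norm_eq_abs]
      norm_num
    have h3 : (3 / 2 : ℝ) ≤ ‖((3 / 2 : ℝ) : ℂ) + t * I‖ := by
      have := Complex.abs_re_le_norm (((3 / 2 : ℝ) : ℂ) + t * I)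
      simp only [Complex.add_re, Complex.ofReal_re, Complex.mul_re, Complex.I_re, mul_zero,
        Complex.ofReal_im, Complex.I_im, mul_one, sub_self, add_zero] at this
      rwa [abs_of_pos (by norm_num : (0 : ℝ) < 3 / 2)] at this
    have h4 := norm_laplaceFactor_pow_mul_le hA hNm (σ := 3 / 2) (by rw [abs_of_pos (by norm_num)]) t
    have hs0 : 0 < ‖((3 / 2 : ℝ) : ℂ) + t * I‖ := by linarith
    rw [h1]
    calc Real.exp (-(3 / 2 * u)) * ‖laplaceFactor A ((3 / 2 : ℝ) + t * I) ^ (m + 1)‖ *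
          (‖F (1 - ((3 / 2 : ℝ) + t * I))‖ / ‖((3 / 2 : ℝ) : ℂ) + t * I‖)
        ≤ Real.exp (-(3 / 2 * u)) * ‖laplaceFactor A ((3 / 2 : ℝ) + t * I) ^ (m + 1)‖ *
          (M * (9 / 2 + |t|) ^ N / (3 / 2)) := by
          refine mul_le_mul_of_nonneg_left (div_le_div₀ (by positivity) h2 (by norm_num) h3) (by positivity)
      _ = 2 / 3 * Real.exp (-(3 / 2 * u)) * M *
          (‖laplaceFactor A ((3 / 2 : ℝ) + t * I) ^ (m + 1)‖ * (9 / 2 + |t|) ^ N) := by ring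
      _ ≤ 2 / 3 * Real.exp (-(3 / 2 * u)) * M * (C / (1 + t ^ 2)) :=
          mul_le_mul_of_nonneg_left h4 (by positivity)
      _ = (2 / 3 * Real.exp (-(3 / 2 * u)) * M * C) * (1 + t ^ 2)⁻¹ := by rw [div_eq_mul_inv]; ring
  have hint := norm_integral_le_of_norm_le ((integrable_inv_one_add_sq).const_mul
    (2 / 3 * Real.exp (-(3 / 2 * u)) * M * C)) (Eventually.of_forall hpt)
  rw [MeasureTheory.integral_const_mul, integral_univ_inv_one_add_sq] at hint
  calc 1 / (2 * π) * ‖∫ t : ℝ, Complex.exp (-(u : ℂ) * ((3 / 2 : ℝ) + t * I)) *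
        laplaceFactor A ((3 / 2 : ℝ) + t * I) ^ (m + 1) *
          (F (1 - ((3 / 2 : ℝ) + t * I)) / (-((3 / 2 : ℝ) + t * I)))‖
      ≤ 1 / (2 * π) * ((2 / 3 * Real.exp (-(3 / 2 * u)) * M * C) * π) :=
        mul_le_mul_of_nonneg_left hint (by positivity)
    _ = 1 / 3 * M * C * Real.exp (-(3 / 2 * u)) := by field_simp

end Literature.NumberTheory.LFunctions.WeissKernel


/-! ## Thorner–Zaman Lemma 4.4 for the class group of a number field -/

namespace Literature.NumberTheory.LFunctions.NumberField

open Literature.NumberTheory.LFunctions.WeissKernel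
open scoped nonZeroDivisors _root_.NumberField

variable {K : Type*} [Field K] [NumberField K]

/-- **Thorner–Zaman Lemma 4.4 for class group characters** (`H = 1`): for a number field `K` of
degree `n_K`, a character `χ : Cl_K →* ℂˣ`, Weiss's kernel of order `m + 1 ≥ n_K + 4` with parameter
`A > 0`, and every real `u` (`x = e^u`),
`|Σ_𝔞 χ([𝔞]) N𝔞^{−1} φ_{m+1}(u − log N𝔞) − Z₁_χ(1)| ≤ (1/3) |d_K| e^{2n_K} C x^{−3/2}`,
`C = majorConst A m (n_K + 1)`, where `Z₁_χ(s) = (s − 1)L(s, χ)` (entire; `Z₁_χ(1) = δ(χ) κ_K`).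
The line `Re s = −1` of the Mellin representation is moved to `Re s = 3/2` using the uniform
convexity bound `norm_sub_one_mul_classGroupLFunction_le`. [cite: ThornerZaman2017, Lemma 4.4] -/
theorem norm_smoothedClassSum_sub_le (χ : ClassGroup (𝓞 K) →* ℂˣ) {A : ℝ} (hA : 0 < A) {m : ℕ}
    (hm : Module.finrank ℚ K + 3 ≤ m) (u : ℝ) :
    ‖smoothedSum (fun n ↦ ∑ I ∈ (Ideal.finite_setOf_absNorm_eq (S := 𝓞 K) n).toFinset,
        rayClassCoeff ⊤ (classGroupCharPrimeValue χ) I) A m u -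
        classTwistedZeta₁ K (fun C ↦ (χ C : ℂ)) 1‖ ≤
      1 / 3 * (((NumberField.discr K).natAbs : ℝ) * Real.exp (2 * Module.finrank ℚ K)) *
        majorConst A m (Module.finrank ℚ K + 1) * Real.exp (-(3 / 2 * u)) := by
  have hψ : ∀ v : IsDedekindDomain.HeightOneSpectrum (𝓞 K), ¬ (⊤ : Ideal (𝓞 K)) ≤ v.asIdeal →
      ‖classGroupCharPrimeValue χ v‖ ≤ 1 := fun v _ ↦ (norm_classGroupCharPrimeValue χ v).le
  refine norm_smoothedSum_sub_le hA (N := Module.finrank ℚ K + 1) (by omega) one_pos le_rfl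
    (LSeriesSummable_sum_rayClassCoeff top_ne_bot hψ (by norm_num)) (differentiable_classTwistedZeta₁ _)
    (fun z hz ↦ ?_) (by positivity) (fun z hz ↦ ?_) u
  · have hz1 : z ≠ 1 := fun h ↦ by rw [h, Complex.one_re] at hz; exact lt_irrefl _ hz
    rw [← classGroupLFunction_eq_LSeries K χ hz, ← sub_one_mul_classGroupLFunction χ hz1]
    field_simp [sub_ne_zero.mpr hz1]
  · exact norm_classTwistedZeta₁_le (fun C ↦ (norm_classGroupChar_apply χ C).le) hz

end Literature.NumberTheory.LFunctions.NumberField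

end
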